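import Summits.HodgeConjecture.CorCM.CyclotomicFourPNormDescent
import Mathlib.FieldTheory.IntermediateField.Adjoin.Basic
import Mathlib.RingTheory.Localization.Integral
import Mathlib.NumberTheory.LegendreSymbol.Basic
import HarnessLib

/-!
# `±i` is not a norm from `ℚ(ζ_{4p})` to `ℚ(i, ζ_p + ζ_p⁻¹)` when `p ≡ 5 (mod 8)` — inside `ℂ`

COR-CM (cell `pub-hodgecm2`), binder seat b04 (gen 25), count-neutral claim CYCLIC-SEMIDIRECT-EIGHT, part IIIc: the arithmetic
hypothesis `hN` of parts I–II (`CorCM/GaloisCyclicSemidirectEightTwoSheet`, `…Nondegenerate`) discharged for the subfield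
`M = ℚ(ζ_{4p}) ⊆ ℂ` and the embedding `ρ : M → ℂ`, `ζ_{4p} ↦ ζ_{4p}^{2p−1}` (which fixes `μ₄` and inverts `μ_p`), from the
descent of part IIIb (`CorCM/CyclotomicFourPNormDescent`).  Mathlib only.  KERNEL ONLY: theorems; no definition, no named
fact, no `sorry`.

THEOREM (`exists_subfield_rho`).  For every prime `p ≡ 5 (mod 8)` there are a subfield `M ⊆ ℂ` containing all `4p`-th roots
of unity and a ring map `ρ : M → ℂ` with `ρ(z) = z` for `z⁴ = 1`, `ρ(z) = z⁻¹` for `z^p = 1`, such that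
  `z₁ ρ(z₁) = ω · z₂ ρ(z₂)`, `ω² = −1`  ⟹  `z₁ = z₂ = 0`.
Classically: `ρ` is the element of `Gal(ℚ(ζ_{4p})/ℚ)` with fixed field `F = ℚ(i, ζ_p + ζ_p⁻¹)`, `z ρ(z) = N_{ℚ(ζ_{4p})/F}(z)`,
and `±i ∉ N(ℚ(ζ_{4p})^×)` is the local obstruction at the primes above `p` (residue field `𝔽_p`, in which `±i` is not a
square iff `p ≢ 1 (mod 8)`) — for `p ≡ 1 (mod 8)` or `p ≡ 3 (mod 4)` there is no obstruction (`i` is a square in the residue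
field), in accordance with the seat census (`C₃ ⋊ C₈`, `C₇ ⋊ C₈` BAD).

* §1 `pow_two_mul_eq_neg_one` (`ζ^{2p} = −1`), `eq_pow_odd_of_sq_eq_neg_one` (`ω² = −1 ⟹ ω = ζ^{pj}`, `j` odd),
  `mem_adjoin_of_pow_eq_one`, `rho_pow` (the action of `ρ` on roots of unity).
* §2 **`exists_subfield_rho`**.

## References

* [FeinGordonSmith1971] B. Fein, B. Gordon, J. H. Smith, J. Number Theory 3 (1971), 310–315.
* [Washington1997] L. C. Washington, *Introduction to Cyclotomic Fields*, Thm. 2.13.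
-/

noncomputable section

open Polynomial IntermediateField

namespace Summit.HodgeConjecture.CorCM.CyclotomicFourP

variable {p : ℕ}

/-! ## §1 Roots of unity in `ℚ(ζ_{4p}) ⊆ ℂ` -/

/-- `ζ^{2p} = −1` for the primitive `4p`-th root `ζ = e^{2πi/4p}`. [folklore] -/
theorem exp_pow_two_mul (hp : 0 < p) : Complex.exp (2 * Real.pi * Complex.I / (4 * p : ℕ)) ^ (2 * p) = -1 := by
  have hζ := Complex.isPrimitiveRoot_exp (4 * p) (by omega)
  set ζ := Complex.exp (2 * Real.pi * Complex.I / (4 * p : ℕ))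
  have h1 : (ζ ^ (2 * p)) ^ 2 = 1 := by rw [← pow_mul, show 2 * p * 2 = 4 * p by ring, hζ.pow_eq_one]
  have hne : ζ ^ (2 * p) ≠ 1 := fun h => by
    have := Nat.le_of_dvd (by omega) (hζ.dvd_of_pow_eq_one _ h); omega
  have h1' : ζ ^ (2 * p) * ζ ^ (2 * p) = 1 := by rw [← pow_two]; exact h1
  rcases mul_self_eq_one_iff.1 h1' with h | h
  · exact absurd h hne
  · exact h

/-- `ω² = −1` in `ℂ` forces `ω = ζ^{pj}` with `j ∈ {1, 3}` odd. [folklore] -/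
theorem eq_pow_odd_of_sq_eq_neg_one (hp : p.Prime) (hp2 : p ≠ 2) {ω : ℂ} (hω : ω ^ 2 = -1) :
    ∃ j : ℕ, Odd j ∧ ω = Complex.exp (2 * Real.pi * Complex.I / (4 * p : ℕ)) ^ (p * j) := by
  have hζ := Complex.isPrimitiveRoot_exp (4 * p) (by have := hp.pos; omega)
  haveI : NeZero (4 * p) := ⟨by have := hp.pos; omega⟩
  set ζ := Complex.exp (2 * Real.pi * Complex.I / (4 * p : ℕ))
  have hω4p : ω ^ (4 * p) = 1 := by rw [pow_mul, show (4 : ℕ) = 2 * 2 by norm_num, pow_mul, hω, neg_one_sq, one_pow]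
  obtain ⟨m, hm, rfl⟩ := hζ.eq_pow_of_pow_eq_one hω4p
  -- `ζ^{4m} = 1` forces `p ∣ m`
  have h4 : (ζ ^ m) ^ 4 = 1 := by rw [show (4 : ℕ) = 2 * 2 by norm_num, pow_mul, hω, neg_one_sq]
  rw [← pow_mul] at h4
  have hdvd : 4 * p ∣ m * 4 := hζ.dvd_of_pow_eq_one _ h4
  obtain ⟨j, hj⟩ : p ∣ m := by
    have : p ∣ m * 4 := Dvd.dvd.trans (Dvd.intro_left 4 rfl) hdvd
    rcases (Nat.Prime.dvd_mul hp).1 this with h | h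
    · exact h
    · exfalso
      have h' : p ∣ 2 ^ 2 := by simpa using h
      exact hp2 ((Nat.prime_dvd_prime_iff_eq hp Nat.prime_two).1 (hp.dvd_of_dvd_pow h'))
  refine ⟨j, ?_, by rw [hj]⟩
  -- `j` is odd: `ω² = ζ^{2pj} = (-1)^j`
  by_contra hev
  rw [Nat.not_odd_iff_even] at hev
  rw [hj, ← pow_mul, show p * j * 2 = 2 * p * j by ring, pow_mul, exp_pow_two_mul hp.pos, hev.neg_one_pow] at hω
  norm_num at hω

/-! ## §2 The subfield `ℚ(ζ_{4p})` and the embedding `ρ : ζ ↦ ζ^{2p−1}` -/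

/-- **THE NORM OBSTRUCTION.**  `p ≡ 5 (mod 8)` prime.  With `M = ℚ(ζ_{4p}) ⊆ ℂ` and `ρ : M → ℂ`, `ζ_{4p} ↦ ζ_{4p}^{2p−1}`:
`M ⊇ μ_{4p}`, `ρ` fixes `μ₄` and inverts `μ_p`, and `z₁ ρ(z₁) = ω z₂ ρ(z₂)` with `ω² = −1` forces `z₁ = z₂ = 0` — `±i` is
not a norm from `ℚ(ζ_{4p})` to `ℚ(i, ζ_p + ζ_p⁻¹)`. [cite: FeinGordonSmith1971, pp. 310–315] -/
theorem exists_subfield_rho (hp : p.Prime) (hp8 : p % 8 = 5) :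
    ∃ (M : Subfield ℂ) (ρ : M →+* ℂ), (∀ z : ℂ, z ^ (4 * p) = 1 → z ∈ M) ∧
      (∀ z : M, (z : ℂ) ^ 4 = 1 → ρ z = z) ∧ (∀ z : M, (z : ℂ) ^ p = 1 → ρ z = (z : ℂ)⁻¹) ∧
      (∀ (z₁ z₂ : M) (ω : ℂ), ω ^ 2 = -1 → (z₁ : ℂ) * ρ z₁ = ω * ((z₂ : ℂ) * ρ z₂) →
        (z₁ : ℂ) = 0 ∧ (z₂ : ℂ) = 0) := by
  classical
  have hp2 : p ≠ 2 := by rintro rfl; norm_num at hp8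
  have hp0 : 0 < p := hp.pos
  haveI : NeZero (4 * p) := ⟨by omega⟩
  haveI : Fact p.Prime := ⟨hp⟩
  have hζ := Complex.isPrimitiveRoot_exp (4 * p) (by omega)
  set ζ := Complex.exp (2 * Real.pi * Complex.I / (4 * p : ℕ)) with hζ_def
  have hζint : IsIntegral ℚ ζ := (hζ.isIntegral (by omega)).tower_top
  -- the power basis of `ℚ⟮ζ⟯` and the embedding `ρ₀ : ζ ↦ ζ^{2p-1}`
  set pb := IntermediateField.adjoin.powerBasis hζint with hpb_def
  have hgen : pb.gen = AdjoinSimple.gen ℚ ζ := IntermediateField.adjoin.powerBasis_gen hζint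
  have hmin : minpoly ℚ pb.gen = cyclotomic (4 * p) ℚ := by
    rw [hgen, cyclotomic_eq_minpoly_rat hζ (by omega)]
    exact IntermediateField.minpoly_gen (F := ℚ) ζ
  have hρ₀ : aeval (ζ ^ (2 * p - 1)) (minpoly ℚ pb.gen) = 0 := by
    rw [hmin, aeval_def, eval₂_eq_eval_map, map_cyclotomic, ← IsRoot.def, isRoot_cyclotomic_iff]
    exact hζ.pow_of_coprime _ (coprime_two_mul_sub_one hp0)
  set ρ₀ : ℚ⟮ζ⟯ →ₐ[ℚ] ℂ := pb.lift (ζ ^ (2 * p - 1)) hρ₀ with hρ₀_def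
  have hρ₀gen : ρ₀ (AdjoinSimple.gen ℚ ζ) = ζ ^ (2 * p - 1) := by
    have h := pb.lift_gen (ζ ^ (2 * p - 1)) hρ₀
    rw [hgen] at h
    exact h
  -- powers of `ζ` as elements of `ℚ⟮ζ⟯`
  have hmem : ∀ m : ℕ, ζ ^ m ∈ ℚ⟮ζ⟯ := fun m => pow_mem (mem_adjoin_simple_self ℚ ζ) m
  have hρ₀pow : ∀ m : ℕ, ρ₀ ⟨ζ ^ m, hmem m⟩ = ζ ^ ((2 * p - 1) * m) := fun m => by
    have : (⟨ζ ^ m, hmem m⟩ : ℚ⟮ζ⟯) = AdjoinSimple.gen ℚ ζ ^ m := Subtype.ext (by simp [AdjoinSimple.coe_gen])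
    rw [this, map_pow, hρ₀gen, ← pow_mul]
  refine ⟨ℚ⟮ζ⟯.toSubfield, ρ₀.toRingHom, fun z hz => ?_, fun z hz => ?_, fun z hz => ?_, fun z₁ z₂ ω hω hrel => ?_⟩
  · -- `μ_{4p} ⊆ M`
    obtain ⟨m, -, rfl⟩ := hζ.eq_pow_of_pow_eq_one hz
    exact hmem m
  · -- `ρ` fixes the fourth roots of unity `ζ^{m}`, `p ∣ m`
    have hz4p : (z : ℂ) ^ (4 * p) = 1 := by rw [pow_mul, hz, one_pow]
    obtain ⟨m, -, hm⟩ := hζ.eq_pow_of_pow_eq_one hz4p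
    have hzm : z = ⟨ζ ^ m, hmem m⟩ := Subtype.ext hm.symm
    have hpm : 4 * p ∣ 4 * m := hζ.dvd_of_pow_eq_one _ (by rw [mul_comm, pow_mul, hm, hz])
    obtain ⟨m', rfl⟩ : p ∣ m := Nat.dvd_of_mul_dvd_mul_left (by norm_num) hpm
    obtain ⟨k, hk⟩ : ∃ k, p = 2 * k + 1 := ⟨p / 2, by have := hp.eq_one_or_self_of_dvd 2; omega⟩
    rw [hzm, AlgHom.toRingHom_eq_coe, RingHom.coe_coe, hρ₀pow]
    change ζ ^ ((2 * p - 1) * (p * m')) = ζ ^ (p * m')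
    have harith : (2 * p - 1) * (p * m') = p * m' + (4 * p) * (k * m') := by
      rw [show 2 * p - 1 = 4 * k + 1 by omega, hk]; ring
    rw [harith, pow_add, show ζ ^ (4 * p * (k * m')) = 1 by rw [pow_mul, hζ.pow_eq_one, one_pow], mul_one]
  · -- `ρ` inverts the `p`-th roots of unity `ζ^{m}`, `4 ∣ m`
    have hz4p : (z : ℂ) ^ (4 * p) = 1 := by rw [mul_comm, pow_mul, hz, one_pow]
    obtain ⟨m, -, hm⟩ := hζ.eq_pow_of_pow_eq_one hz4p
    have hzm : z = ⟨ζ ^ m, hmem m⟩ := Subtype.ext hm.symm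
    have hpm : 4 * p ∣ p * m := hζ.dvd_of_pow_eq_one _ (by rw [mul_comm, pow_mul, hm, hz])
    obtain ⟨m', rfl⟩ : 4 ∣ m := Nat.dvd_of_mul_dvd_mul_left hp0 (by rw [mul_comm 4 p] at hpm; exact hpm)
    rw [hzm, AlgHom.toRingHom_eq_coe, RingHom.coe_coe, hρ₀pow]
    change ζ ^ ((2 * p - 1) * (4 * m')) = (ζ ^ (4 * m'))⁻¹
    refine eq_inv_of_mul_eq_one_left ?_
    have harith : (2 * p - 1) * (4 * m') + 4 * m' = (4 * p) * (2 * m') := by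
      rw [← add_one_mul, show 2 * p - 1 + 1 = 2 * p by omega]; ring
    rw [← pow_add, harith, pow_mul, hζ.pow_eq_one, one_pow]
  · -- the norm obstruction
    replace hrel : (z₁ : ℂ) * ρ₀ z₁ = ω * ((z₂ : ℂ) * ρ₀ z₂) := hrel
    by_cases hz₂ : (z₂ : ℂ) = 0
    · refine ⟨?_, hz₂⟩
      rw [hz₂, zero_mul, mul_zero] at hrel
      rcases mul_eq_zero.1 hrel with h | h
      · exact h
      · rw [map_eq_zero] at h
        rw [h]; rfl
    exfalso
    -- `w = z₁ / z₂` has `w ρ(w) = ω`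
    set w : ℚ⟮ζ⟯ := z₁ / z₂ with hw_def
    have hz₂' : z₂ ≠ 0 := fun h => hz₂ (by rw [h]; rfl)
    have hρz₂ : ρ₀ z₂ ≠ 0 := by rw [Ne, map_eq_zero]; exact hz₂'
    have hwrel : (w : ℂ) * ρ₀ w = ω := by
      rw [hw_def, map_div₀]
      push_cast
      rw [div_mul_div_comm, div_eq_iff (mul_ne_zero hz₂ hρz₂), hrel]
    -- `ω = ζ^{pj}`, `j` odd
    obtain ⟨j, hj, hωj⟩ := eq_pow_odd_of_sq_eq_neg_one hp hp2 hω
    -- `w = f(ζ)`, `f ∈ ℚ[X]`; clear denominators: `F = b f ∈ ℤ[X]`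
    have hwmem : (w : ℂ) ∈ Algebra.adjoin ℚ {ζ} := by
      rw [← adjoin_simple_toSubalgebra_of_isAlgebraic hζint.isAlgebraic]
      exact w.2
    rw [Algebra.adjoin_singleton_eq_range_aeval] at hwmem
    obtain ⟨f, hf⟩ := hwmem
    replace hf : aeval ζ f = (w : ℂ) := hf
    obtain ⟨b, hb, hF⟩ := IsLocalization.integerNormalization_spec (nonZeroDivisors ℤ) f
    set F := IsLocalization.integerNormalization (nonZeroDivisors ℤ) f with hF_def
    have hb0 : b ≠ 0 := nonZeroDivisors.ne_zero hb
    have hFζ : ∀ x : ℂ, aeval x F = (b : ℂ) * aeval x f := fun x => by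
      rw [← aeval_map_algebraMap ℚ x F, hF, map_zsmul, zsmul_eq_mul]
    -- `ρ₀ (f(ζ)) = f(ζ^{2p-1})`
    have hwgen : w = aeval (AdjoinSimple.gen ℚ ζ) f := by
      apply Subtype.ext
      have h := IntermediateField.aeval_coe (S := ℚ⟮ζ⟯) (R := ℚ) (AdjoinSimple.gen ℚ ζ) f
      rw [AdjoinSimple.coe_gen] at h
      exact hf.symm.trans h
    have hρw : ρ₀ w = aeval (ζ ^ (2 * p - 1)) f := by
      rw [hwgen]
      have h := pb.lift_aeval (ζ ^ (2 * p - 1)) hρ₀ f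
      simp only [hgen] at h
      exact h
    -- the relation in `Λ = ℤ[X]/(Φ_{4p})`
    set n : ℕ := b.natAbs with hn_def
    have hn : 0 < n := Int.natAbs_pos.2 hb0
    have hev := lift_exp_injective hp0
    have hrelΛ : AdjoinRoot.mk (cyclotomic (4 * p) ℤ) F *
        AdjoinRoot.lift (algebraMap ℤ _) (AdjoinRoot.root (cyclotomic (4 * p) ℤ) ^ (2 * p - 1))
          (eval₂_root_pow_cyclotomic hp0 (coprime_two_mul_sub_one hp0)) (AdjoinRoot.mk (cyclotomic (4 * p) ℤ) F) =
        (n : AdjoinRoot (cyclotomic (4 * p) ℤ)) ^ 2 * (AdjoinRoot.root (cyclotomic (4 * p) ℤ) ^ (p * j) * 1) := by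
      apply hev
      have h1 : AdjoinRoot.lift (algebraMap ℤ ℂ) _ (eval₂_cyclotomic_exp hp0) (AdjoinRoot.mk (cyclotomic (4 * p) ℤ) F) =
          aeval ζ F := lift_exp_mk hp0 F
      have h2 : AdjoinRoot.lift (algebraMap ℤ ℂ) _ (eval₂_cyclotomic_exp hp0)
          (AdjoinRoot.lift (algebraMap ℤ _) (AdjoinRoot.root (cyclotomic (4 * p) ℤ) ^ (2 * p - 1))
            (eval₂_root_pow_cyclotomic hp0 (coprime_two_mul_sub_one hp0)) (AdjoinRoot.mk (cyclotomic (4 * p) ℤ) F)) =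
          aeval (ζ ^ (2 * p - 1)) F := by
        rw [AdjoinRoot.lift_mk, hom_eval₂, map_pow, AdjoinRoot.lift_root]
        have hc : (AdjoinRoot.lift (algebraMap ℤ ℂ) ζ (eval₂_cyclotomic_exp hp0)).comp
            (algebraMap ℤ (AdjoinRoot (cyclotomic (4 * p) ℤ))) = algebraMap ℤ ℂ := Subsingleton.elim _ _
        rw [hc, ← aeval_def]
      have hn2 : ((n : ℕ) : ℂ) ^ 2 = (b : ℂ) ^ 2 := by
        have e := congrArg (Int.cast : ℤ → ℂ) (Int.natAbs_pow_two b)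
        rwa [Int.cast_pow, Int.cast_pow, Int.cast_natCast] at e
      rw [map_mul, h1, h2, map_mul, map_mul, map_pow, map_natCast, map_one, mul_one, map_pow, AdjoinRoot.lift_root,
        hn2, ← hωj, hFζ, hFζ, hf, ← hρw, ← hwrel]
      ring
    obtain ⟨s, hs⟩ : IsSquare (-1 : ZMod p) := ZMod.exists_sq_eq_neg_one_iff.2 (by omega)
    have hs' : s ^ 2 = -1 := by rw [pow_two, ← hs]
    exact descent hp hp8 hs' hj n hn _ 1 1 one_ne_zero (by rw [map_one, one_pow]) hrelΛ

end Summit.HodgeConjecture.CorCM.CyclotomicFourP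

end
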